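import Mathlib
import Summits.Ventures.PercRepro2.Defs
import Summits.Ventures.PercRepro2.Independence
import Summits.Ventures.PercRepro2.Harris
import Summits.Ventures.PercRepro2.Graph
import Summits.Ventures.PercRepro2.Exploration
import Summits.Ventures.PercRepro2.Events
import Summits.Ventures.PercRepro2.Induced
import Summits.Ventures.PercRepro2.BHK
import Summits.Ventures.PercRepro2.BHKEvents
import Summits.Ventures.PercRepro2.OneEdge
import Summits.Ventures.PercRepro2.RBRoot
import Summits.Ventures.PercRepro2.RBRootEdge
import Summits.Ventures.PercRepro2.RBRootEdgePin
import Summits.Ventures.PercRepro2.RBRootEdgeMain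
import Summits.Ventures.PercRepro2.RBRootIsolated
import Summits.Ventures.PercRepro2.RBTwoMarkers
import Summits.Ventures.PercRepro2.RBTwoMarkersCross

/-!
# Row 2′RB at a third vertex adjacent only to the two markers — cross form, II (mine-a g5; §32)

`cross_two_markers_of_zero`: with `e₁ = {w, b}`, `e₂ = {w, o}` the only edges of nonzero weight
at `w` and `w ∉ {s, t, b, o}`, the cross form of the row holds at `w` (`cross_two_markers`: the
case in which they are the only edges at `w`). Under both edges open, `bL` and `oH`
are `{s ∈ C(w)}` and `{t ∈ C(w)}`, disjoint on `Q`; opening both edges on a configuration in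
which `w` is isolated identifies `b` with `o` (`conn_force_two`), which gives the lower bounds
`M ≥ A − P₁`, `M′ ≥ D − P₁` and `Z₁ ≤ Z − P₁` for the both-open masses in terms of the `G − w`
masses (`P₁ = P(Q ∩ bL ∩ oH)`; `prob_both_open_bounds`); with BHK 1.4 on `G − w` (`P₁ Z ≤ A D`)
the cleared mixture inequality `mix_cross_var` closes — the `r → 0` form `m/a + m′/d ≥ 1` of
MINE-A.md §32. Also here: the leaf invariance of the cross masses (`prob_leaf_update_cross`), the
two-edge forcing lemma `conn_force_two` and the null set `prob_both_open_cross`.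
-/

namespace Summit.Ventures.PercRepro2

namespace RBTwoMarkers

open scoped Classical

section CrossMain

variable {V : Type*} {E : Type*} [Fintype E] [DecidableEq E] [Fintype V] {R : Type*} [Field R]
  [LinearOrder R] [IsStrictOrderedRing R] (ends : E → Sym2 V) (s t w : V)

omit [Fintype V] [LinearOrder R] [IsStrictOrderedRing R] in
/-- **Leaf invariance of the cross masses**: with `p e₂ = 0` pinned, forcing `e₁ = {w, v}` does not
change `P(S)` for `S ∈ {Q, Q ∩ bL, Q ∩ oH, Q ∩ bL ∩ oH}`. -/
lemma prob_leaf_update_cross {p : E → R} {e₁ e₂ : E} {v b o : V}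
    (H : ∀ e, w ∈ ends e → e = e₁ ∨ e = e₂) (hends : ends e₁ = s(w, v)) (hws : s ≠ w) (hwt : t ≠ w)
    (hwb : b ≠ w) (hwo : o ≠ w) (c : R) (hc : c = 0 ∨ c = 1) :
    prob (Function.update (Function.update p e₂ 0) e₁ c) (connEvent ends s t)ᶜ =
        prob (Function.update p e₂ 0) (connEvent ends s t)ᶜ ∧
      prob (Function.update (Function.update p e₂ 0) e₁ c) ((connEvent ends s t)ᶜ ∩ connEvent ends b s) =
        prob (Function.update p e₂ 0) ((connEvent ends s t)ᶜ ∩ connEvent ends b s) ∧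
      prob (Function.update (Function.update p e₂ 0) e₁ c) ((connEvent ends s t)ᶜ ∩ connEvent ends o t) =
        prob (Function.update p e₂ 0) ((connEvent ends s t)ᶜ ∩ connEvent ends o t) ∧
      prob (Function.update (Function.update p e₂ 0) e₁ c)
          ((connEvent ends s t)ᶜ ∩ connEvent ends b s ∩ connEvent ends o t) =
        prob (Function.update p e₂ 0) ((connEvent ends s t)ᶜ ∩ connEvent ends b s ∩ connEvent ends o t) := by
  have hz : ∀ e, w ∈ ends e ∧ e ≠ e₁ → Function.update p e₂ 0 e = 0 := by
    rintro e ⟨he, hne⟩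
    rcases H e he with rfl | rfl
    · exact absurd rfl hne
    · exact Function.update_self _ _ _
  obtain ⟨h1, h2, -, h3, -, h4⟩ :=
    prob_leaf_update_events ends w (Function.update p e₂ 0) hz hends s t b o hws hwt hwb hwo c hc
  exact ⟨h1, h2, h3, h4⟩

omit [Fintype E] [Fintype V] [Field R] [LinearOrder R] [IsStrictOrderedRing R] in
/-- **Two-edge forcing**: on a configuration in which every edge at `w` is closed, opening
`e₁ = {w, b}` and `e₂ = {w, o}` identifies `b` with `o`. -/
lemma conn_force_two {e₁ e₂ : E} {b o : V} (hends₁ : ends e₁ = s(w, b)) (hends₂ : ends e₂ = s(w, o))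
    (hwo : o ≠ w) {ω : Config E} (hcl : ∀ e, w ∈ ends e → ω e = false) {x y : V} (hx : x ≠ w)
    (hy : y ≠ w) :
    Conn ends (Function.update (Function.update ω e₁ true) e₂ true) x y ↔
      Conn ends ω x y ∨ (Conn ends ω x b ∧ Conn ends ω o y) ∨ (Conn ends ω x o ∧ Conn ends ω b y) := by
  have hiso : ∀ z, Conn ends ω z w ↔ z = w := by
    intro z
    constructor
    · intro h
      have hz : z ∈ cluster ends ω w := conn_symm h
      rw [cluster_eq_singleton_of_closed ends w hcl] at hz
      exact hz
    · rintro rfl; exact conn_refl _ _ _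
  -- after opening `e₁`: `x ↔ y` unchanged for `x, y ≠ w`; `x ↔ w` iff `x ↔ b`
  have h1 : ∀ x' y', x' ≠ w → y' ≠ w →
      (Conn ends (Function.update ω e₁ true) x' y' ↔ Conn ends ω x' y') := by
    intro x' y' hx' hy'
    rw [OneEdge.conn_update_true_iff hends₁]
    constructor
    · rintro (h | ⟨h, _⟩ | ⟨_, h⟩)
      · exact h
      · exact absurd ((hiso x').1 h) hx'
      · exact absurd ((hiso y').1 (conn_symm h)) hy'
    · exact fun h => Or.inl h
  have h1w : ∀ x', x' ≠ w → (Conn ends (Function.update ω e₁ true) x' w ↔ Conn ends ω x' b) := by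
    intro x' hx'
    rw [OneEdge.conn_update_true_iff hends₁]
    constructor
    · rintro (h | ⟨h, _⟩ | ⟨h, _⟩)
      · exact absurd ((hiso x').1 h) hx'
      · exact absurd ((hiso x').1 h) hx'
      · exact h
    · exact fun h => Or.inr (Or.inr ⟨h, conn_refl _ _ _⟩)
  have h1w' : Conn ends (Function.update ω e₁ true) w y ↔ Conn ends ω b y :=
    ⟨fun h => conn_symm ((h1w y hy).1 (conn_symm h)), fun h => conn_symm ((h1w y hy).2 (conn_symm h))⟩
  rw [OneEdge.conn_update_true_iff hends₂, h1 x y hx hy, h1w x hx, h1 o y hwo hy, h1 x o hx hwo, h1w']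

omit [Fintype V] [LinearOrder R] [IsStrictOrderedRing R] in
/-- Under both marker edges open, `Q ∩ bL ∩ oH` is null: `s` and `t` would both lie in `C(w)`. -/
lemma prob_both_open_cross (p : E → R) {e₁ e₂ : E} {b o : V} (hends₁ : ends e₁ = s(w, b))
    (hends₂ : ends e₂ = s(w, o)) (hne : e₁ ≠ e₂) :
    prob (Function.update (Function.update p e₂ 1) e₁ 1)
      ((connEvent ends s t)ᶜ ∩ connEvent ends b s ∩ connEvent ends o t) = 0 := by
  have h2 : ∀ S : Set (Config E), prob (Function.update (Function.update p e₂ 1) e₁ 1) S =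
      prob (Function.update (Function.update p e₂ 1) e₁ 1) (S ∩ openEdge e₂ ∩ openEdge e₁) := by
    intro S
    rw [prob_update_one_inter_openEdge (Function.update p e₂ 1) (S ∩ openEdge e₂) e₁,
      Function.update_comm hne.symm, prob_update_one_inter_openEdge (Function.update p e₁ 1) S e₂]
  rw [h2]
  have : ((connEvent ends s t)ᶜ ∩ connEvent ends b s ∩ connEvent ends o t) ∩ openEdge e₂ ∩ openEdge e₁ =
      ∅ := by
    ext ω
    simp only [Set.mem_inter_iff, Set.mem_compl_iff, mem_connEvent, mem_openEdge,
      Set.mem_empty_iff_false, iff_false]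
    rintro ⟨⟨⟨⟨hQ, hb⟩, ho⟩, h2'⟩, h1⟩
    apply hQ
    have hbw : Conn ends ω b w := conn_symm (conn_of_openAdj ⟨e₁, h1, hends₁⟩)
    have how : Conn ends ω o w := conn_symm (conn_of_openAdj ⟨e₂, h2', hends₂⟩)
    exact conn_trans (conn_symm hb) (conn_trans hbw (conn_trans (conn_symm how) ho))
  rw [this, prob_empty]

omit [Fintype V] in
/-- **Double-forcing bounds.** On `G − w` (both marker edges closed) opening both edges identifies
`b ≡ o` (`conn_force_two`); hence `P₁₁(Q ∩ bL) ≥ P₀₀(Q ∩ bL ∩ oHᶜ)`, `P₁₁(Q ∩ oH) ≥ P₀₀(Q ∩ oH ∩ bLᶜ)`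
and `P₁₁(Q) ≤ P₀₀(Q ∩ (bL ∩ oH)ᶜ)`. -/
lemma prob_both_open_bounds {p : E → R} (hp : IsProbVec p) {e₁ e₂ : E} {b o : V}
    (hz : ∀ e, w ∈ ends e → e ≠ e₁ → e ≠ e₂ → p e = 0) (hends₁ : ends e₁ = s(w, b))
    (hends₂ : ends e₂ = s(w, o))
    (hne : e₁ ≠ e₂) (hws : s ≠ w) (hwt : t ≠ w) (hwb : b ≠ w) (hwo : o ≠ w) :
    prob (Function.update (Function.update p e₂ 0) e₁ 0)
        ((connEvent ends s t)ᶜ ∩ connEvent ends b s ∩ (connEvent ends o t)ᶜ) ≤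
      prob (Function.update (Function.update p e₂ 1) e₁ 1) ((connEvent ends s t)ᶜ ∩ connEvent ends b s) ∧
    prob (Function.update (Function.update p e₂ 0) e₁ 0)
        ((connEvent ends s t)ᶜ ∩ connEvent ends o t ∩ (connEvent ends b s)ᶜ) ≤
      prob (Function.update (Function.update p e₂ 1) e₁ 1) ((connEvent ends s t)ᶜ ∩ connEvent ends o t) ∧
    prob (Function.update (Function.update p e₂ 1) e₁ 1) (connEvent ends s t)ᶜ ≤
      prob (Function.update (Function.update p e₂ 0) e₁ 0)
        ((connEvent ends s t)ᶜ ∩ (connEvent ends b s ∩ connEvent ends o t)ᶜ) := by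
  have hp00 : IsProbVec (Function.update (Function.update p e₂ 0) e₁ 0) :=
    (hp.update e₂ le_rfl zero_le_one).update e₁ le_rfl zero_le_one
  -- every edge at `w` has weight `0` under `p[e₂ ↦ 0][e₁ ↦ 0]`: the law lives on «`w` isolated»
  have hz00 : ∀ e, w ∈ ends e → Function.update (Function.update p e₂ 0) e₁ 0 e = 0 := by
    intro e he
    by_cases h₁ : e = e₁
    · subst h₁; exact Function.update_self _ _ _
    · rw [Function.update_of_ne h₁]
      by_cases h₂ : e = e₂
      · subst h₂; exact Function.update_self _ _ _
      · rw [Function.update_of_ne h₂]; exact hz e he h₁ h₂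
  have key : ∀ (S T : Set (Config E)), (∀ ω : Config E, (∀ e, w ∈ ends e → ω e = false) → ω ∈ S →
      Function.update (Function.update ω e₁ true) e₂ true ∈ T) →
      prob (Function.update (Function.update p e₂ 0) e₁ 0) S ≤
        prob (Function.update (Function.update p e₂ 1) e₁ 1) T := by
    intro S T hST
    rw [prob_both_open_eq p hne, prob_inter_closed_of_zero _ _ hz00 S,
      prob_inter_closed_of_zero _ _ hz00 {ω | Function.update (Function.update ω e₁ true) e₂ true ∈ T}]
    refine prob_mono hp00 ?_
    rintro ω ⟨hS, hcl⟩
    exact ⟨hST ω hcl hS, hcl⟩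
  have key' : ∀ (S T : Set (Config E)), (∀ ω : Config E, (∀ e, w ∈ ends e → ω e = false) →
      Function.update (Function.update ω e₁ true) e₂ true ∈ S → ω ∈ T) →
      prob (Function.update (Function.update p e₂ 1) e₁ 1) S ≤
        prob (Function.update (Function.update p e₂ 0) e₁ 0) T := by
    intro S T hST
    rw [prob_both_open_eq p hne, prob_inter_closed_of_zero _ _ hz00 T,
      prob_inter_closed_of_zero _ _ hz00 {ω | Function.update (Function.update ω e₁ true) e₂ true ∈ S}]
    refine prob_mono hp00 ?_
    rintro ω ⟨hS, hcl⟩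
    exact ⟨hST ω hcl hS, hcl⟩
  refine ⟨key _ _ ?_, key _ _ ?_, key' _ _ ?_⟩
  · rintro ω hc ⟨⟨hQ, hb⟩, ho⟩
    simp only [Set.mem_inter_iff, Set.mem_compl_iff, mem_connEvent] at hQ hb ho ⊢
    refine ⟨?_, (conn_force_two ends w hends₁ hends₂ hwo hc hwb hws).2 (Or.inl hb)⟩
    rw [conn_force_two ends w hends₁ hends₂ hwo hc hws hwt]
    rintro (h | ⟨_, h2⟩ | ⟨_, h2⟩)
    · exact hQ h
    · exact ho h2
    · exact hQ (conn_trans (conn_symm hb) h2)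
  · rintro ω hc ⟨⟨hQ, ho⟩, hb⟩
    simp only [Set.mem_inter_iff, Set.mem_compl_iff, mem_connEvent] at hQ hb ho ⊢
    refine ⟨?_, (conn_force_two ends w hends₁ hends₂ hwo hc hwo hwt).2 (Or.inl ho)⟩
    rw [conn_force_two ends w hends₁ hends₂ hwo hc hws hwt]
    rintro (h | ⟨h1, _⟩ | ⟨h1, _⟩)
    · exact hQ h
    · exact hb (conn_symm h1)
    · exact hQ (conn_trans h1 ho)
  · rintro ω hc hQ
    simp only [Set.mem_inter_iff, Set.mem_compl_iff, mem_connEvent] at hQ ⊢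
    rw [conn_force_two ends w hends₁ hends₂ hwo hc hws hwt] at hQ
    exact ⟨fun h => hQ (Or.inl h), fun h => hQ (Or.inr (Or.inl ⟨conn_symm h.1, h.2⟩))⟩

/-- **Row 2′RB, cross form, at a third vertex whose only neighbours are the two markers**
(MINE-A.md §32, cross form): pin `e₂ = {w, o}` and `e₁ = {w, b}`; `e₂` open collapses the sum at
`o`, `e₂` closed and `e₁` open collapses it at `b`, both closed is the isolated case; the both-open
masses are controlled by the `G − w` masses through `prob_both_open_bounds`, and BHK 1.4 on `G − w`
(`RBRoot.cross_collapsed`) together with `mix_cross_var` closes the mixture. -/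
theorem cross_two_markers_of_zero {p : E → R} (hp : IsProbVec p) {e₁ e₂ : E} {b o : V}
    (hz : ∀ e, w ∈ ends e → e ≠ e₁ → e ≠ e₂ → p e = 0) (hends₁ : ends e₁ = s(w, b))
    (hends₂ : ends e₂ = s(w, o)) (hne : e₁ ≠ e₂) (hws : s ≠ w) (hwt : t ≠ w) (hwb : b ≠ w)
    (hwo : o ≠ w) :
    RBRoot.rbSum p ends s t w (connEvent ends b s) (connEvent ends o t) ≤
      prob p ((connEvent ends s t)ᶜ ∩ connEvent ends b s) *
        prob p ((connEvent ends s t)ᶜ ∩ connEvent ends o t) / prob p (connEvent ends s t)ᶜ := by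
  have hz₂ : ∀ e, w ∈ ends e ∧ e ≠ e₁ → Function.update p e₂ 0 e = 0 := by
    rintro e ⟨he, hne₁⟩
    by_cases h : e = e₂
    · subst h; exact Function.update_self _ _ _
    · rw [Function.update_of_ne h]; exact hz e he hne₁ h
  have hz₁ : ∀ e, w ∈ ends e ∧ e ≠ e₂ → Function.update p e₁ 0 e = 0 := by
    rintro e ⟨he, hne₂⟩
    by_cases h : e = e₁
    · subst h; exact Function.update_self _ _ _
    · rw [Function.update_of_ne h]; exact hz e he h hne₂
  have hp21 : IsProbVec (Function.update p e₂ 1) := hp.update e₂ zero_le_one le_rfl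
  have hp20 : IsProbVec (Function.update p e₂ 0) := hp.update e₂ le_rfl zero_le_one
  have hp11 : IsProbVec (Function.update (Function.update p e₂ 1) e₁ 1) :=
    hp21.update e₁ zero_le_one le_rfl
  have hβ21 : Function.update p e₂ 1 e₁ = p e₁ := Function.update_of_ne hne _ _
  have hβ20 : Function.update p e₂ 0 e₁ = p e₁ := Function.update_of_ne hne _ _
  -- leaf invariances
  obtain ⟨L1a, L1b, -, L1c, -, L1d⟩ := prob_leaf_update_events ends w (Function.update p e₂ 0) hz₂
    hends₁ s t b o hws hwt hwb hwo 1 (Or.inr rfl)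
  obtain ⟨L0a, L0b, -, L0c, -, L0d⟩ := prob_leaf_update_events ends w (Function.update p e₂ 0) hz₂
    hends₁ s t b o hws hwt hwb hwo 0 (Or.inl rfl)
  obtain ⟨L01a, L01b, -, L01c, -, L01d⟩ := prob_leaf_update_events ends w (Function.update p e₁ 0)
    hz₁ hends₂ s t b o hws hwt hwb hwo 1 (Or.inr rfl)
  obtain ⟨L00a, L00b, -, L00c, -, L00d⟩ := prob_leaf_update_events ends w (Function.update p e₁ 0)
    hz₁ hends₂ s t b o hws hwt hwb hwo 0 (Or.inl rfl)
  rw [Function.update_comm hne] at L01a L01b L01c L01d L00a L00b L00c L00d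
  have hnull := prob_both_open_cross ends s t w p hends₁ hends₂ hne
  obtain ⟨hM, hM', hZ₁'⟩ :=
    prob_both_open_bounds ends s t w hp hz hends₁ hends₂ hne hws hwt hwb hwo
  -- the masses on `G − w` (weights `p[e₂ ↦ 0]`) and under both edges open
  set A := prob (Function.update p e₂ 0) ((connEvent ends s t)ᶜ ∩ connEvent ends b s) with hA
  set D := prob (Function.update p e₂ 0) ((connEvent ends s t)ᶜ ∩ connEvent ends o t) with hD
  set Z := prob (Function.update p e₂ 0) (connEvent ends s t)ᶜ with hZ
  set J := prob (Function.update p e₂ 0) ((connEvent ends s t)ᶜ ∩ connEvent ends b s ∩ connEvent ends o t)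
    with hJ
  set M := prob (Function.update (Function.update p e₂ 1) e₁ 1)
    ((connEvent ends s t)ᶜ ∩ connEvent ends b s) with hMdef
  set M' := prob (Function.update (Function.update p e₂ 1) e₁ 1)
    ((connEvent ends s t)ᶜ ∩ connEvent ends o t) with hM'def
  set Z₁ := prob (Function.update (Function.update p e₂ 1) e₁ 1) (connEvent ends s t)ᶜ with hZ₁
  -- `p[e₂↦1][e₁↦0]` sees `G − w`
  have E01 : prob (Function.update (Function.update p e₂ 1) e₁ 0) (connEvent ends s t)ᶜ = Z ∧
      prob (Function.update (Function.update p e₂ 1) e₁ 0) ((connEvent ends s t)ᶜ ∩ connEvent ends b s) = A ∧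
      prob (Function.update (Function.update p e₂ 1) e₁ 0) ((connEvent ends s t)ᶜ ∩ connEvent ends o t) = D ∧
      prob (Function.update (Function.update p e₂ 1) e₁ 0)
        ((connEvent ends s t)ᶜ ∩ connEvent ends b s ∩ connEvent ends o t) = J := by
    refine ⟨?_, ?_, ?_, ?_⟩
    · rw [L01a, ← L00a, L0a]
    · rw [L01b, ← L00b, L0b]
    · rw [L01c, ← L00c, L0c]
    · rw [L01d, ← L00d, L0d]
  -- (a) the masses under `p`
  have hPb : prob p ((connEvent ends s t)ᶜ ∩ connEvent ends b s) =
      p e₂ * p e₁ * M + (1 - p e₂ * p e₁) * A := by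
    rw [prob_eq_pin p _ e₂, prob_eq_pin (Function.update p e₂ 1) _ e₁, hβ21, ← hMdef, E01.2.1,
      prob_eq_pin (Function.update p e₂ 0) _ e₁, hβ20, L1b, L0b]
    ring
  have hPo : prob p ((connEvent ends s t)ᶜ ∩ connEvent ends o t) =
      p e₂ * p e₁ * M' + (1 - p e₂ * p e₁) * D := by
    rw [prob_eq_pin p _ e₂, prob_eq_pin (Function.update p e₂ 1) _ e₁, hβ21, ← hM'def, E01.2.2.1,
      prob_eq_pin (Function.update p e₂ 0) _ e₁, hβ20, L1c, L0c]
    ring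
  have hPQ : prob p (connEvent ends s t)ᶜ = p e₂ * p e₁ * Z₁ + (1 - p e₂ * p e₁) * Z := by
    rw [prob_eq_pin p _ e₂, prob_eq_pin (Function.update p e₂ 1) _ e₁, hβ21, ← hZ₁, E01.1,
      prob_eq_pin (Function.update p e₂ 0) _ e₁, hβ20, L1a, L0a]
    ring
  -- (b) the Rao–Blackwell sum
  have hS1 : RBRoot.rbSum (Function.update p e₂ 1) ends s t w (connEvent ends b s) (connEvent ends o t) =
      (1 - p e₁) * J := by
    rw [rbSum_update_one_cross_o ends s t w p hp hends₂ b, prob_eq_pin (Function.update p e₂ 1) _ e₁,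
      hβ21, hnull, E01.2.2.2, mul_zero, zero_add]
  have hS10 : RBRoot.rbSum (Function.update (Function.update p e₂ 0) e₁ 1) ends s t w
      (connEvent ends b s) (connEvent ends o t) = J := by
    rw [rbSum_update_one_cross_b ends s t w (Function.update p e₂ 0) hp20 hends₁ o, L1d]
  have hiso : ∀ e, w ∈ ends e → Function.update (Function.update p e₂ 0) e₁ 0 e = 0 := by
    intro e he
    by_cases h₁ : e = e₁
    · subst h₁; simp
    · rw [Function.update_of_ne h₁]; exact hz₂ e ⟨he, h₁⟩
  have hS00 : RBRoot.rbSum (Function.update (Function.update p e₂ 0) e₁ 0) ends s t w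
      (connEvent ends b s) (connEvent ends o t) = A * D / Z := by
    rw [RBRoot.rbSum_isolated _ ends w hiso s t, L0a, L0b, L0c]
  have hS : RBRoot.rbSum p ends s t w (connEvent ends b s) (connEvent ends o t) =
      p e₂ * ((1 - p e₁) * J) + (1 - p e₂) * (p e₁ * J + (1 - p e₁) * (A * D / Z)) := by
    rw [rbSum_pin_cross_o ends s t w hp hends₂ b, hS1, rbSum_pin_cross_b ends s t w hp20 hends₁ o,
      hβ20, hS10, hS00]
  -- (c) BHK 1.4 on `G − w`, the double-forcing bounds and the mixture inequality
  have hBHK : J ≤ A * D / Z := RBRoot.cross_collapsed ends hp20 o b s t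
  have hx0 : 0 ≤ p e₂ * p e₁ := mul_nonneg (hp.nonneg e₂) (hp.nonneg e₁)
  have hx1 : p e₂ * p e₁ ≤ 1 := mul_le_one₀ (hp.le_one e₂) (hp.nonneg e₁) (hp.le_one e₁)
  have hM0 : 0 ≤ M := prob_nonneg hp11 _
  have hMZ : M ≤ Z₁ := prob_mono hp11 Set.inter_subset_left
  have hM'0 : 0 ≤ M' := prob_nonneg hp11 _
  have hA0 : 0 ≤ A := prob_nonneg hp20 _
  have hAZ : A ≤ Z := prob_mono hp20 Set.inter_subset_left
  have hD0 : 0 ≤ D := prob_nonneg hp20 _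
  have hDZ : D ≤ Z := prob_mono hp20 Set.inter_subset_left
  have hJ0 : 0 ≤ J := prob_nonneg hp20 _
  have hJZ : J ≤ Z := prob_mono hp20 (Set.inter_subset_left.trans Set.inter_subset_left)
  have hJZ' : J * Z ≤ A * D := by
    rcases eq_or_lt_of_le (hJ0.trans hJZ) with hZ0 | hZ0
    · rw [← hZ0, mul_zero]
      exact mul_nonneg hA0 hD0
    · exact (le_div_iff₀ hZ0).1 hBHK
  have hMlow : A - J ≤ M := by
    have := prob_inter_add_prob_inter_compl (Function.update (Function.update p e₂ 0) e₁ 0)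
      ((connEvent ends s t)ᶜ ∩ connEvent ends b s) (connEvent ends o t)
    rw [L0d, L0b] at this
    linarith [hM, this]
  have hM'low : D - J ≤ M' := by
    have := prob_inter_add_prob_inter_compl (Function.update (Function.update p e₂ 0) e₁ 0)
      ((connEvent ends s t)ᶜ ∩ connEvent ends o t) (connEvent ends b s)
    rw [RBRoot.inter_inter_comm (connEvent ends s t)ᶜ (connEvent ends o t) (connEvent ends b s),
      L0d, L0c] at this
    linarith [hM', this]
  have hZ₁low : Z₁ ≤ Z - J := by
    have := prob_inter_add_prob_inter_compl (Function.update (Function.update p e₂ 0) e₁ 0)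
      (connEvent ends s t)ᶜ (connEvent ends b s ∩ connEvent ends o t)
    rw [← Set.inter_assoc, L0d, L0a] at this
    linarith [hZ₁', this]
  have hmix := mix_cross_var (x := p e₂ * p e₁) (A := A) (D := D) (Z := Z) (P₁ := J) (M := M)
    (M' := M') (Z₁ := Z₁) hx0 hx1 hA0 hAZ hD0 hDZ hJZ' hMlow hM0 hMZ hM'low hM'0 hZ₁low
  rw [hS, hPb, hPo, hPQ]
  refine le_trans ?_ hmix
  have hcoef : 0 ≤ p e₂ * (1 - p e₁) + (1 - p e₂) * p e₁ :=
    add_nonneg (mul_nonneg (hp.nonneg e₂) (sub_nonneg.2 (hp.le_one e₁)))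
      (mul_nonneg (sub_nonneg.2 (hp.le_one e₂)) (hp.nonneg e₁))
  have hpos := mul_nonneg hcoef (sub_nonneg.2 hBHK)
  have key : (1 - p e₂ * p e₁) * (A * D / Z) -
      (p e₂ * ((1 - p e₁) * J) + (1 - p e₂) * (p e₁ * J + (1 - p e₁) * (A * D / Z))) =
      (p e₂ * (1 - p e₁) + (1 - p e₂) * p e₁) * (A * D / Z - J) := by ring
  linarith [key, hpos]


/-- **Row 2′RB, cross form, at a third vertex whose only edges are the two marker edges**
(MINE-A.md §32, cross form): the special case of `cross_two_markers_of_zero` in which `e₁`, `e₂`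
are the only edges at `w`. -/
theorem cross_two_markers {p : E → R} (hp : IsProbVec p) {e₁ e₂ : E} {b o : V}
    (H : ∀ e, w ∈ ends e → e = e₁ ∨ e = e₂) (hends₁ : ends e₁ = s(w, b))
    (hends₂ : ends e₂ = s(w, o)) (hne : e₁ ≠ e₂) (hws : s ≠ w) (hwt : t ≠ w) (hwb : b ≠ w)
    (hwo : o ≠ w) :
    RBRoot.rbSum p ends s t w (connEvent ends b s) (connEvent ends o t) ≤
      prob p ((connEvent ends s t)ᶜ ∩ connEvent ends b s) *
        prob p ((connEvent ends s t)ᶜ ∩ connEvent ends o t) / prob p (connEvent ends s t)ᶜ :=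
  cross_two_markers_of_zero ends s t w hp (fun e he hne₁ hne₂ => by
    rcases H e he with rfl | rfl
    · exact absurd rfl hne₁
    · exact absurd rfl hne₂) hends₁ hends₂ hne hws hwt hwb hwo

end CrossMain

end RBTwoMarkers

end Summit.Ventures.PercRepro2
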